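import Summits.ResolutionOfSingularities.ResolutionOfSingularities.Theorems.FrobeniusClosingSteerCleanedOrderMonotone
import Summits.ResolutionOfSingularities.ResolutionOfSingularities.Theorems.FrobeniusClosingSteerDivisorTriggerTwoChart
import Summits.ResolutionOfSingularities.ResolutionOfSingularities.Theorems.FrobeniusClosingSteerVisitLawForms
import Mathlib.Algebra.CharP.Two
import HarnessLib

/-!
# Crux `Steer` (stmt-ResolutionOfSingularities-16345), chain W4.1, hARᵒ slot S1a (`VisitLawAt`, res-L0-w41-tri-1 MEMBER-DATUM words,
# plan-1 RULING 132a/140c): **the cleaned order ALONG THE EXCEPTIONAL DIVISOR after a point step is exactly `ν − 2`** (`p = 2`)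

OURS (campaign `res-hironaka`, rung L ★L-G4, W4.1; seat res-type-096 g9; NOT a statement of the manuscript under review
[claim: Hironaka2017, status: under-review]; AI-produced, weaker than expert review). Definition-free, Theses-free. Step (α) of
res-type-096's S1a plan. Setting: `S ⊆ K` regular local dominated by the valuation ring `O`, `x₀ ∈ 𝔪_S` an exceptional parameter,
`S' = (S[𝔪/x₀])_{𝔪_O ∩ S[𝔪/x₀]}` (`locAtCentre (blowupRing S x₀) O`).
* `exists_eval_sub_pow_mul_sq_mem_pow_succ` — CHART FORM ([CoP1] proof of Prop. 4.2, (10)–(11), read for squares): if the weak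
  transform `F(e)` of a form `F` of degree `ν` (non-zero reduction) is a SQUARE modulo `φ(c_j)` locally at a prime `𝔴 ∋ φ(c_j)` of the
  chart `B_j`, then `F(c) ≡ c_j^(ν % 2)·q²  (mod 𝔪^(ν+1))`: modulo the exceptional divisor (`chartQuotEquiv`) the weak transform is the
  dehomogenized initial form `g ≠ 0`, a square in `k[T]_𝔮` hence in the UFD `k[T]`, so `F̄ = T_j^(ν % 2)·Q̄²` (`VisitLawForms`).
* `sq_mod_exc_of_weakTransform` — `Subring` currency via `θ_L : (B_j)_N ≅ S'`: `h ∈ 𝔪^ν ∖ 𝔪^(ν+1)`, `w = h/x₀^ν ≡ γ²  (mod x₀ S')`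
  ⇒ `γ ≠ 0` and `h ≡ x₀^(ν % 2)·q²  (mod 𝔪^(ν+1))`.
* `clord_exc_of_pointStep` — THE THEOREM (char `2`): `f ∈ S` of CLEANED ORDER EXACTLY `ν ≥ 2`, `f'·x₀² = f − g₁²` ⇒
  `f' ≡ γ₀²  (mod x₀^(ν−2))` for some `γ₀ ∈ S'` and `f' − γ² ∉ x₀^(ν−1)·S'` for every `γ ∈ S'` (tri-1's `HasClordAlongAt … x (ν−2)` after
  a point step; with `VisitLawBricks` the `m = ν/2` count of D·S4 / `VisitLawAt` clauses 2–4).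
[cite: CossartPiltant2008, proof of Prop. 4.2, (10) and (11)] [folklore]
-/

noncomputable section

-- `Summit.<S>.<S>.…` duplicates the summit name by design (single-problem summit).
set_option linter.dupNamespace false

namespace Summit.ResolutionOfSingularities.ResolutionOfSingularities.Theorems.SwitchingDichotomy

open Literature.AlgebraicGeometry.Resolution MvPolynomial IsLocalRing

namespace VisitLaw

/-! ## Squares in a localization of a domain -/

/-- If `g ∈ P` (a domain) becomes a square `(ψ γ)²` in a localization `L = M⁻¹P` (`M` without zero divisors), then `g · b² = a²`
for some `a, b ∈ P`, `b ≠ 0`; and `γ = 0` forces `g = 0`. (Stated with an auxiliary ring map `ψ` into `L` so that no arithmetic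
in `L` is needed at the call site.) [folklore] -/
theorem exists_mul_sq_eq_sq_of_isLocalization {P L L₁ : Type*} [CommRing P] [IsDomain P] [CommRing L] [Algebra P L]
    [CommRing L₁] (M : Submonoid P) [IsLocalization M L] (hM : M ≤ nonZeroDivisors P) (ψ : L₁ →+* L) (γ : L₁)
    {g : P} (h : algebraMap P L g = ψ γ ^ 2) :
    (∃ a b : P, b ≠ 0 ∧ g * b ^ 2 = a ^ 2) ∧ (γ = 0 → g = 0) := by
  have hinj : Function.Injective (algebraMap P L) := IsLocalization.injective L hM
  obtain ⟨⟨a, b⟩, hab⟩ := IsLocalization.mk'_surjective M (ψ γ)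
  refine ⟨⟨a, b, nonZeroDivisors.ne_zero (hM b.2), hinj ?_⟩, fun hγ => hinj ?_⟩
  · rw [map_mul, map_pow, map_pow, h, ← hab, ← mul_pow, IsLocalization.mk'_spec]
  · rw [h, hγ, map_zero, map_zero, zero_pow two_ne_zero]

/-! ## The chart computation: a weak transform which is a square modulo the exceptional divisor -/

section Chart

universe u

variable {R : Type u} [CommRing R] [IsRegularLocalRing R] {d : ℕ}
  (hd : (maximalIdeal R).spanFinrank = d) (c : Fin d → R)
  (hc : Ideal.span (Set.range c) = maximalIdeal R)

include hd hc in
/-- **Square descent on the chart** (`R` regular local, rsop `c`, form `F` of degree `ν` with non-zero reduction, chart `B_j`, prime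
`𝔴 ∋ φ(c_j)`): if the weak transform `F(e) ≡ γ²` modulo `φ(c_j)` in `(B_j)_𝔴`, then `γ ≠ 0` and `F(c) ≡ c_j^(ν % 2)·q²` modulo `𝔪^(ν+1)`
for some `q ∈ R` (via `B_j/(c_j) ≅ k[T_l : l ≠ j]`, squares descend from `k[T]_𝔮` to the UFD `k[T]`, square descent of forms). OURS. [folklore] -/
theorem exists_eval_sub_pow_mul_sq_mem_pow_succ (j : Fin d) {F : MvPolynomial (Fin d) R} {ν : ℕ}
    (hF : F.IsHomogeneous ν) (hF0 : MvPolynomial.map (Ideal.Quotient.mk (Ideal.span (Set.range c))) F ≠ 0)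
    (𝔴 : Ideal (chartRing c j)) [𝔴.IsPrime] (h𝔴 : chartBase c j (c j) ∈ 𝔴) (γ : Localization.AtPrime 𝔴)
    (hγ : (algebraMap (chartRing c j) (Localization.AtPrime 𝔴) : chartRing c j →+* Localization.AtPrime 𝔴)
        (MvPolynomial.eval₂Hom (chartBase c j) (fun l => chartGen c j l) F) - γ ^ 2 ∈
      Ideal.span {(algebraMap (chartRing c j) (Localization.AtPrime 𝔴) : chartRing c j →+* Localization.AtPrime 𝔴)
        (chartBase c j (c j))}) :
    γ ≠ 0 ∧ ∃ q : R, MvPolynomial.eval c F - c j ^ (ν % 2) * q ^ 2 ∈ maximalIdeal R ^ (ν + 1) := by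
  classical
  haveI hImax : (Ideal.span (Set.range c)).IsMaximal := by
    rw [hc]; exact maximalIdeal.isMaximal R
  letI : Field (R ⧸ Ideal.span (Set.range c)) := Ideal.Quotient.field _
  set g : MvPolynomial {l : Fin d // l ≠ j} (R ⧸ Ideal.span (Set.range c)) :=
    MvPolynomial.map (Ideal.Quotient.mk _) (dehomogenize j F) with hg
  have hg0 : g ≠ 0 := by
    rw [hg, map_dehomogenize]
    exact dehomogenize_ne_zero_of_isHomogeneous j (hF.map _) hF0
  have hquot : chartQuotMap c j g = Ideal.Quotient.mk (Ideal.span {chartBase c j (c j)})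
      (MvPolynomial.eval₂Hom (chartBase c j) (fun l => chartGen c j l) F) := by
    rw [hg, ← RingHom.comp_apply, chartQuotMap_comp_map, RingHom.comp_apply]
    congr 1
    exact RingHom.congr_fun (eval₂Hom_comp_aeval_kill c j) F
  have hcq : IsQuasiRegular c := by
    have := isQuasiRegular_rsop_comp hd c hc id Function.injective_id
    rwa [Function.comp_id] at this
  set K : Ideal (chartRing c j) := Ideal.span {chartBase c j (c j)} with hK
  let ρ : chartRing c j →+* MvPolynomial {l : Fin d // l ≠ j} (R ⧸ Ideal.span (Set.range c)) :=
    (chartQuotEquiv c j hcq).symm.toRingHom.comp (Ideal.Quotient.mk K)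
  have hρsurj : Function.Surjective ρ :=
    (chartQuotEquiv c j hcq).symm.surjective.comp Ideal.Quotient.mk_surjective
  have hρker : RingHom.ker ρ = K := by
    ext b
    rw [RingHom.mem_ker, RingHom.comp_apply, RingEquiv.toRingHom_eq_coe, RingEquiv.coe_toRingHom,
      EmbeddingLike.map_eq_zero_iff, Ideal.Quotient.eq_zero_iff_mem]
  have hρF : ρ (MvPolynomial.eval₂Hom (chartBase c j) (fun l => chartGen c j l) F) = g := by
    change (chartQuotEquiv c j hcq).symm (Ideal.Quotient.mk K _) = g
    rw [← hquot, ← chartQuotEquiv_apply c j hcq, RingEquiv.symm_apply_apply]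
  have hρc : ρ (chartBase c j (c j)) = 0 := by
    rw [← RingHom.mem_ker, hρker, hK]
    exact Ideal.mem_span_singleton_self _
  have hK𝔴 : K ≤ 𝔴 := by
    rw [hK, Ideal.span_singleton_le_iff_mem]
    exact h𝔴
  haveI h𝔮 : (𝔴.map ρ).IsPrime := Ideal.map_isPrime_of_surjective hρsurj (by rwa [hρker])
  have hcomap : 𝔴 = (𝔴.map ρ).comap ρ := by
    rw [Ideal.comap_map_of_surjective ρ hρsurj, ← RingHom.ker_eq_comap_bot, hρker,
      sup_eq_left.mpr hK𝔴]
  set ψ := Localization.localRingHom 𝔴 (𝔴.map ρ) ρ hcomap with hψ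
  have hψF : ψ ((algebraMap (chartRing c j) (Localization.AtPrime 𝔴) : chartRing c j →+* Localization.AtPrime 𝔴)
      (MvPolynomial.eval₂Hom (chartBase c j) (fun l => chartGen c j l) F)) =
      algebraMap _ (Localization.AtPrime (𝔴.map ρ)) g := by
    rw [hψ, Localization.localRingHom_to_map, hρF]
  have hψc : ψ ((algebraMap (chartRing c j) (Localization.AtPrime 𝔴) : chartRing c j →+* Localization.AtPrime 𝔴)
      (chartBase c j (c j))) = 0 := by
    rw [hψ, Localization.localRingHom_to_map, hρc, map_zero]
  have h1 : algebraMap _ (Localization.AtPrime (𝔴.map ρ)) g = ψ γ ^ 2 := by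
    have hmem := Ideal.mem_map_of_mem ψ hγ
    rw [Ideal.map_span, Set.image_singleton, hψc, Ideal.span_singleton_eq_bot.mpr rfl, Ideal.mem_bot,
      map_sub, map_pow, hψF, sub_eq_zero] at hmem
    exact hmem
  obtain ⟨⟨a, b, hb0, h2⟩, hzero⟩ := exists_mul_sq_eq_sq_of_isLocalization
    (P := MvPolynomial {l : Fin d // l ≠ j} (R ⧸ Ideal.span (Set.range c))) (L := Localization.AtPrime (𝔴.map ρ))
    (𝔴.map ρ).primeCompl (Ideal.primeCompl_le_nonZeroDivisors _) ψ γ h1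
  obtain ⟨q, hq⟩ := exists_eq_sq_of_mul_sq_eq_sq hb0 h2
  have hg' : dehomogenize j (MvPolynomial.map (Ideal.Quotient.mk (Ideal.span (Set.range c))) F) = q ^ 2 := by
    rw [← map_dehomogenize, ← hg, hq]
  obtain ⟨Qb, hQb, hFQb⟩ := eq_X_pow_mul_sq_of_dehomogenize_eq_sq j (hF.map _) q hg'
  obtain ⟨Q, hQ, hQQb⟩ := exists_isHomogeneous_map_eq (Ideal.Quotient.mk (Ideal.span (Set.range c)))
    Ideal.Quotient.mk_surjective hQb
  refine ⟨fun hγ0 => hg0 (hzero hγ0), MvPolynomial.eval c Q, ?_⟩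
  have hXQ : (X j ^ (ν % 2) * Q ^ 2 : MvPolynomial (Fin d) R).IsHomogeneous ν := by
    have h3 : (X j ^ (ν % 2) * Q ^ 2 : MvPolynomial (Fin d) R).IsHomogeneous (1 * (ν % 2) + ν / 2 * 2) :=
      ((isHomogeneous_X R j).pow (ν % 2)).mul (hQ.pow 2)
    have h4 : 1 * (ν % 2) + ν / 2 * 2 = ν := by omega
    rwa [h4] at h3
  have hG : (F - X j ^ (ν % 2) * Q ^ 2).IsHomogeneous ν := hF.sub hXQ
  have hG0 : MvPolynomial.map (Ideal.Quotient.mk (Ideal.span (Set.range c))) (F - X j ^ (ν % 2) * Q ^ 2) = 0 := by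
    rw [map_sub, map_mul, map_pow, map_pow, MvPolynomial.map_X, hQQb, ← hFQb, sub_self]
  have hG0' : MvPolynomial.map (residue R) (F - X j ^ (ν % 2) * Q ^ 2) = 0 := by
    ext m
    have := congrArg (MvPolynomial.coeff m) hG0
    rw [MvPolynomial.coeff_map, MvPolynomial.coeff_zero, Ideal.Quotient.eq_zero_iff_mem, hc] at this
    rw [MvPolynomial.coeff_map, MvPolynomial.coeff_zero, residue_eq_zero_iff]
    exact this
  have h5 := eval_mem_pow_succ_of_map_residue_eq_zero c hc hG hG0'
  rw [map_sub, map_mul, map_pow, map_pow, MvPolynomial.eval_X] at h5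
  exact h5

end Chart

/-! ## Transport along a ring isomorphism (no arithmetic in the localization at the call site) -/

/-- `e a ≡ γ²  (mod e x)` gives `a ≡ (e⁻¹ γ)²  (mod x)`. [folklore] -/
theorem sub_sq_mem_span_of_ringEquiv {A B : Type*} [CommRing A] [CommRing B] (e : A ≃+* B) {a x : A} {γ : B}
    (h : e a - γ ^ 2 ∈ Ideal.span {e x}) : a - e.symm γ ^ 2 ∈ Ideal.span {x} := by
  obtain ⟨c, hc⟩ := Ideal.mem_span_singleton'.mp h
  refine Ideal.mem_span_singleton'.mpr ⟨e.symm c, e.injective ?_⟩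
  rw [map_mul, e.apply_symm_apply, map_sub, map_pow, e.apply_symm_apply, hc]

/-- `e⁻¹ γ ≠ 0` gives `γ ≠ 0`. [folklore] -/
theorem ne_zero_of_ringEquiv_symm_ne_zero {A B : Type*} [CommRing A] [CommRing B] (e : A ≃+* B) {γ : B}
    (h : e.symm γ ≠ 0) : γ ≠ 0 := fun h0 => h (by rw [h0, map_zero])

/-! ## The `Subring` currency: the local blowing up `S' = (S[𝔪/x₀])_{𝔪_O ∩ S[𝔪/x₀]}` inside `K` -/

variable {K : Type} [Field K]

/-- **A weak transform which is a square modulo the exceptional divisor** (`Subring` currency, through `θ_L : (S[𝔪t])_{(x₀t),N} ≅ S'`):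
`h ∈ 𝔪_S^ν ∖ 𝔪_S^(ν+1)` with weak transform `w = h/x₀^ν ∈ S'`; if `w ≡ γ²` modulo `x₀ S'` then `γ ≠ 0` and `h ≡ x₀^(ν % 2)·q²` modulo
`𝔪_S^(ν+1)` for some `q ∈ S`. OURS. [cite: CossartPiltant2008, proof of Prop. 4.2, (10) and (11)] [folklore] -/
theorem sq_mod_exc_of_weakTransform {O : ValuationSubring K} {S S' : Subring K} [IsRegularLocalRing S]
    (hdom : SubringDominates S O.toSubring) {x₀ : S} (hx₀m : x₀ ∈ maximalIdeal S) (hx₀0 : x₀ ≠ 0)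
    (hmin : ∀ y ∈ maximalIdeal S, O.valuation (y : K) ≤ O.valuation (x₀ : K))
    (hS' : S' = locAtCentre (blowupRing S (x₀ : K)) O)
    {h : S} {ν : ℕ} (hν : h ∈ maximalIdeal S ^ ν) (hν' : h ∉ maximalIdeal S ^ (ν + 1))
    (hx₀S' : (x₀ : K) ∈ S') (w γ : S') (hw : (w : K) * (x₀ : K) ^ ν = (h : K))
    (hγ : w - γ ^ 2 ∈ Ideal.span {(⟨x₀, hx₀S'⟩ : S')}) :
    γ ≠ 0 ∧ ∃ q : S, h - x₀ ^ (ν % 2) * q ^ 2 ∈ maximalIdeal S ^ (ν + 1) := by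
  classical
  have hx₀K : (x₀ : K) ≠ 0 := fun e => hx₀0 (Subtype.ext e)
  have hx₀2 : x₀ ∉ maximalIdeal S ^ 2 := QuadraticStep.not_mem_sq_of_forall_valuation_le hdom hx₀K hmin
  obtain ⟨e, c, hd, hc, hc0⟩ := (LowMult.isRsopPart_one_of_not_mem_sq hx₀m hx₀2).exists_rsop
  have hci : c (Fin.castAdd e 0) = x₀ := hc0 0
  set i : Fin (1 + e) := Fin.castAdd e 0 with hi
  have hθ : S.subtype (c i) ≠ 0 := by rw [hci]; exact hx₀K
  have hRO : ∀ r : S, S.subtype r ∈ O := fun r => hdom.1 r.2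
  have hdom' : ∀ r ∈ maximalIdeal S, O.valuation (S.subtype r) < 1 := fun r hr =>
    ((subringDominates_valuationSubring_iff hdom.1).mp hdom r).mp hr
  have hmin' : ∀ j, O.valuation (S.subtype (c j)) ≤ O.valuation (S.subtype (c i)) := fun j => by
    rw [hci]
    exact hmin _ (hc ▸ Ideal.subset_span ⟨j, rfl⟩)
  set N := chartCentre c i S.subtype hθ O hRO hmin' with hN
  have hNi : chartBase c i (c i) ∈ N := by
    rw [hN, mem_chartCentre_iff, chartToField_reesChartBase]
    exact hdom' _ (hci ▸ hx₀m)
  -- the initial form of `h` and its weak transform `f₁` on the chart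
  obtain ⟨F, hF, hFf, hF0⟩ := exists_isHomogeneous_eval_eq_map_residue_ne_zero c hc hν hν'
  set f₁ := MvPolynomial.eval₂Hom (chartBase c i) (fun l => chartGen c i l) F with hf₁
  have hφf : chartBase c i h = chartBase c i (c i) ^ ν * f₁ := by
    rw [← hFf]
    exact reesChartBase_eval_eq_pow_mul_eval₂ c i hF
  -- `θ_L : L ≅ S'`
  set φL := locToField c i S.subtype hθ O hRO hmin' (Localization.AtPrime N) with hφL
  have hinj : Function.Injective φL :=
    locToField_injective_rsopStep c i S.subtype hθ Subtype.val_injective O hRO hmin' _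
  have hrange : φL.range = S' := by
    rw [hS', hφL, range_locToField,
      range_chartToField_eq_blowupRing c i S.subtype hθ hc S (Subring.range_subtype S)]
    simp [hci]
  obtain ⟨eqv, heqv⟩ := exists_ringEquiv_of_range_eq_rsopStep φL hinj S' hrange
  -- values in `K`: `θ_L(φ c_i) = x₀`, `θ_L(f₁) = w`
  have heqc : eqv ((algebraMap (chartRing c i) (Localization.AtPrime N) :
      chartRing c i →+* Localization.AtPrime N) (chartBase c i (c i))) = ⟨x₀, hx₀S'⟩ := by
    apply Subtype.ext
    rw [heqv, hφL, locToField_algebraMap, chartToField_reesChartBase, hci]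
    rfl
  have heqf : eqv ((algebraMap (chartRing c i) (Localization.AtPrime N) :
      chartRing c i →+* Localization.AtPrime N) f₁) = w := by
    apply Subtype.ext
    rw [heqv, hφL, locToField_algebraMap]
    have h3 : (chartBase c i) (c i) ^ ν = (chartBase c i) (c i ^ ν) := (map_pow (chartBase c i) (c i) ν).symm
    rw [h3] at hφf
    have h1 := congrArg (chartToField c i S.subtype hθ) hφf
    rw [map_mul, chartToField_reesChartBase, chartToField_reesChartBase] at h1
    have h4 : S.subtype (c i ^ ν) = (x₀ : K) ^ ν := by
      rw [hci]
      rfl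
    rw [h4] at h1
    -- `h1 : (h : K) = x₀ ^ ν * θ f₁`
    have hxν : (x₀ : K) ^ ν ≠ 0 := pow_ne_zero ν hx₀K
    apply mul_right_cancel₀ hxν
    rw [hw]
    change _ = S.subtype h
    rw [h1, mul_comm]
  -- transport `w ≡ γ²  (mod x₀)` to `L`
  have hγ' := hγ
  rw [← heqf, ← heqc] at hγ'
  have hγL := sub_sq_mem_span_of_ringEquiv eqv hγ'
  obtain ⟨hne, q, hq⟩ := exists_eval_sub_pow_mul_sq_mem_pow_succ hd c hc i hF hF0 N hNi (eqv.symm γ) hγL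
  refine ⟨ne_zero_of_ringEquiv_symm_ne_zero eqv hne, q, ?_⟩
  rw [hFf, hci] at hq
  exact hq

/-- **The cleaned order ALONG THE EXCEPTIONAL DIVISOR after a point step is EXACTLY `ν − 2`** (`p = 2`; tri-1 D·S4): `f ∈ S` of cleaned
order exactly `ν ≥ 2` (`f − g₀² ∈ 𝔪^ν`, `f − q² ∉ 𝔪^(ν+1)` for all `q`), `f'·x₀² = f − g₁²` a point-step transform. Then `f' ≡ γ₀²`
modulo `x₀^(ν−2)` (`γ₀ = (g₁ − g₀)/x₀`), and `f' − γ² ∉ x₀^(ν−1)·S'` for EVERY `γ ∈ S'`: otherwise (`x₀` prime in `S'`, `S'/(x₀)` regular)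
the weak transform of `f − g₀²` would be a square modulo `x₀` (`ν` even) or divisible by `x₀` (`ν` odd), re-cleaning `f` into `𝔪^(ν+1)`.
OURS. [cite: CossartPiltant2008, proof of Prop. 4.2, (10) and (11)] [folklore] -/
theorem clord_exc_of_pointStep [CharP K 2] {O : ValuationSubring K} {S S' : Subring K}
    [IsRegularLocalRing S] [IsLocalRing S'] (hdom : SubringDominates S O.toSubring)
    {x₀ : S} (hx₀m : x₀ ∈ maximalIdeal S) (hx₀0 : x₀ ≠ 0)
    (hmin : ∀ y ∈ maximalIdeal S, O.valuation (y : K) ≤ O.valuation (x₀ : K))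
    (hS' : S' = locAtCentre (blowupRing S (x₀ : K)) O) (hx₀S' : (x₀ : K) ∈ S')
    (f g₀ g₁ : S) (f' : S') {ν : ℕ} (hν2 : 2 ≤ ν)
    (hg₀ : f - g₀ ^ 2 ∈ maximalIdeal S ^ ν) (hexact : ∀ q : S, f - q ^ 2 ∉ maximalIdeal S ^ (ν + 1))
    (hrel : (f' : K) * (x₀ : K) ^ 2 = (f : K) - (g₁ : K) ^ 2) :
    (∃ γ : S', f' - γ ^ 2 ∈ Ideal.span {(⟨x₀, hx₀S'⟩ : S') ^ (ν - 2)}) ∧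
      ∀ γ : S', f' - γ ^ 2 ∉ Ideal.span {(⟨x₀, hx₀S'⟩ : S') ^ (ν - 1)} := by
  classical
  have hx₀K : (x₀ : K) ≠ 0 := fun e => hx₀0 (Subtype.ext e)
  have hRO : S ≤ O.toSubring := hdom.1
  have hval : ∀ a : S, a ∈ maximalIdeal S ↔ O.valuation (a : K) < 1 :=
    (subringDominates_valuationSubring_iff hRO).mp hdom
  have hvx : O.valuation (x₀ : K) < 1 := (hval x₀).mp hx₀m
  have hBO : blowupRing S (x₀ : K) ≤ O.toSubring := by
    refine Subring.closure_le.mpr ?_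
    rintro z (hz | ⟨y, hy, rfl⟩)
    · exact hRO hz
    · change (y : K) / x₀ ∈ O
      rw [← O.valuation_le_one_iff, map_div₀]
      exact div_le_one_of_le₀ (hmin y hy) zero_le
  have hS'O : S' ≤ O.toSubring := by
    rw [hS']
    exact locAtCentre_le hBO
  have hdiv : ∀ y : S, y ∈ maximalIdeal S → (y : K) / x₀ ∈ S' := fun y hy => by
    rw [hS']
    exact le_locAtCentre _ O (div_mem_blowupRing (x₀ : K) hy)
  have h2K : (2 : K) = 0 := CharTwo.two_eq_zero
  have h2S : (2 : S) = 0 := Subtype.ext (by push_cast; exact h2K)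
  have h2S' : (2 : S') = 0 := Subtype.ext (by push_cast; exact h2K)
  set x' : S' := ⟨x₀, hx₀S'⟩ with hx'def
  have hx'0 : x' ≠ 0 := fun h => hx₀K (congrArg Subtype.val h)
  -- the weak transform `w` of `h = f − g₀²`
  obtain ⟨w, hw, -⟩ := CleanedOrderMonotone.exists_div_pow_not_mem_pow_succ hdom hx₀m hx₀0 hmin hS' hg₀ (hexact g₀)
  have hwK : (w : K) * (x₀ : K) ^ ν = (f : K) - (g₀ : K) ^ 2 := by
    rw [hw]
    push_cast
    ring
  -- `g₁ − g₀ ∈ 𝔪_S`, so `γ₀ := (g₁ − g₀)/x₀ ∈ S'`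
  have hsub : f - g₁ ^ 2 ∈ maximalIdeal S := by
    rw [hval]
    have e1 : ((f - g₁ ^ 2 : S) : K) = (f' : K) * (x₀ : K) ^ 2 := by
      push_cast
      rw [hrel]
    rw [e1, map_mul, map_pow]
    calc O.valuation (f' : K) * O.valuation (x₀ : K) ^ 2 ≤ 1 * O.valuation (x₀ : K) ^ 2 :=
          mul_le_mul' ((O.valuation_le_one_iff _).mpr (hS'O f'.2)) le_rfl
      _ < 1 := by
        rw [one_mul]
        exact pow_lt_one₀ zero_le hvx two_ne_zero
  have hum : g₁ - g₀ ∈ maximalIdeal S := by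
    have hsq : (g₁ - g₀) ^ 2 = (f - g₀ ^ 2) - (f - g₁ ^ 2) := by
      linear_combination (g₀ ^ 2 - g₀ * g₁) * h2S
    have hmem : (g₁ - g₀) ^ 2 ∈ maximalIdeal S := by
      rw [hsq]
      exact sub_mem (Ideal.pow_le_self (by omega) hg₀) hsub
    exact (inferInstance : (maximalIdeal S).IsPrime).mem_of_pow_mem 2 hmem
  set γ₀ : S' := ⟨((g₁ - g₀ : S) : K) / x₀, hdiv _ hum⟩ with hγ₀
  -- lower bound: `f' − γ₀² = x₀^(ν−2) · w`
  have hpow : (x₀ : K) ^ ν = (x₀ : K) ^ (ν - 2) * (x₀ : K) ^ 2 := by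
    rw [← pow_add, Nat.sub_add_cancel hν2]
  have hlow : f' - γ₀ ^ 2 = x' ^ (ν - 2) * w := by
    apply Subtype.ext
    have hx2K : (x₀ : K) ^ 2 ≠ 0 := pow_ne_zero 2 hx₀K
    apply mul_right_cancel₀ hx2K
    change ((f' : K) - (((g₁ - g₀ : S) : K) / x₀) ^ 2) * (x₀ : K) ^ 2 = (x₀ : K) ^ (ν - 2) * (w : K) * (x₀ : K) ^ 2
    have e5 : (x₀ : K) ^ (ν - 2) * (w : K) * (x₀ : K) ^ 2 = (w : K) * (x₀ : K) ^ ν := by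
      rw [hpow]
      ring
    rw [sub_mul, div_pow, div_mul_cancel₀ _ hx2K, hrel, e5, hwK]
    push_cast
    linear_combination (g₁ * g₀ - g₁ ^ 2) * h2K
  have hlowmem : f' - γ₀ ^ 2 ∈ Ideal.span {x' ^ (ν - 2)} :=
    Ideal.mem_span_singleton'.mpr ⟨w, by rw [hlow, mul_comm]⟩
  -- `x'` is prime in `S'`: `S'/(x₀)` is a regular local ring
  have hx₀2 : x₀ ∉ maximalIdeal S ^ 2 := QuadraticStep.not_mem_sq_of_forall_valuation_le hdom hx₀K hmin
  have hx₀m1 : (⟨(x₀ : K), x₀.2⟩ : S) ∈ maximalIdeal S := by simpa using hx₀m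
  have hx₀21 : (⟨(x₀ : K), x₀.2⟩ : S) ∉ maximalIdeal S ^ 2 := by simpa using hx₀2
  haveI hCreg : IsRegularRing (blowupRing S (x₀ : K) ⧸
      Ideal.span {(⟨(x₀ : K), le_blowupRing S (x₀ : K) x₀.2⟩ : blowupRing S (x₀ : K))}) :=
    DivisorTrigger.isRegularRing_blowupRing_quotient S x₀.2 hx₀m1 hx₀21 hx₀K
  have hregP : IsRegularLocalRing (S' ⧸ Ideal.span {x'}) := by
    have hq := DivisorTrigger.isRegularLocalRing_locAtCentre_quotient hBO
      ⟨(x₀ : K), le_blowupRing S (x₀ : K) x₀.2⟩ hvx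
    have key : ∀ (T : Subring K) (hT : T = locAtCentre (blowupRing S (x₀ : K)) O) (hxT : (x₀ : K) ∈ T),
        IsRegularLocalRing (T ⧸ Ideal.span {(⟨x₀, hxT⟩ : T)}) := by
      intro T hT hxT
      subst hT
      exact hq
    exact key S' hS' hx₀S'
  haveI : IsDomain (S' ⧸ Ideal.span {x'}) := by
    haveI := hregP
    exact isDomain_of_isRegularLocalRing _
  have hprime : Prime x' :=
    (Ideal.span_singleton_prime hx'0).mp ((Ideal.Quotient.isDomain_iff_prime _).mp inferInstance)
  refine ⟨⟨γ₀, hlowmem⟩, fun γ hmem => ?_⟩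
  obtain ⟨a, ha⟩ := Ideal.mem_span_singleton'.mp hmem
  -- `(γ₀ − γ)² = x₀^(ν−2) · (a x₀ − w)`
  have hdiff : (γ₀ - γ) ^ 2 = x' ^ (ν - 2) * (a * x' - w) := by
    have e1 : (γ₀ - γ) ^ 2 = (f' - γ ^ 2) - (f' - γ₀ ^ 2) + 2 * (γ * γ - γ₀ * γ) := by ring
    have hp : x' ^ (ν - 1) = x' ^ (ν - 2) * x' := by
      rw [← pow_succ]
      congr 1
      omega
    rw [e1, h2S', zero_mul, add_zero, ← ha, hlow, hp]
    ring
  rcases Nat.even_or_odd ν with ⟨k, hk⟩ | ⟨k, hk⟩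
  · -- `ν` even: `w` is a square modulo `x₀`, contradicting the cleaned order `ν`
    have hν2' : ν - 2 = 2 * (k - 1) := by omega
    have hdvd : x' ^ (2 * (k - 1)) ∣ (γ₀ - γ) ^ 2 := ⟨a * x' - w, by rw [hdiff, hν2']⟩
    obtain ⟨ε, hε⟩ := pow_dvd_of_pow_two_mul_dvd_sq hprime (k - 1) _ hdvd
    have hεsq : ε ^ 2 = a * x' - w := by
      have e2 : x' ^ (2 * (k - 1)) * ε ^ 2 = x' ^ (2 * (k - 1)) * (a * x' - w) := by
        rw [← hν2', ← hdiff, hε, hν2']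
        ring
      exact mul_left_cancel₀ (pow_ne_zero _ hx'0) e2
    have hwε : w - ε ^ 2 ∈ Ideal.span {x'} :=
      Ideal.mem_span_singleton'.mpr ⟨a, by linear_combination hεsq + (a * x' - w) * h2S'⟩
    obtain ⟨-, q, hq⟩ := sq_mod_exc_of_weakTransform hdom hx₀m hx₀0 hmin hS' hg₀ (hexact g₀) hx₀S' w ε hw hwε
    have hpar : ν % 2 = 0 := by omega
    rw [hpar, pow_zero, one_mul] at hq
    apply hexact (g₀ + q)
    have e3 : f - (g₀ + q) ^ 2 = f - g₀ ^ 2 - q ^ 2 - g₀ * q * 2 := by ring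
    rw [e3, h2S, mul_zero, sub_zero]
    exact hq
  · -- `ν` odd: `w` is divisible by `x₀`, contradicting `ord h = ν`
    have hν2' : ν - 2 = 2 * (k - 1) + 1 := by omega
    have hdvd : x' ^ (2 * (k - 1) + 1) ∣ (γ₀ - γ) ^ 2 := ⟨a * x' - w, by rw [hdiff, hν2']⟩
    obtain ⟨ε, hε⟩ := pow_succ_dvd_of_pow_two_mul_succ_dvd_sq hprime (k - 1) _ hdvd
    have e2 : x' ^ (ν - 2) * (a * x' - w) = x' ^ (ν - 2) * (x' * ε ^ 2) := by
      rw [← hdiff, hε, hν2']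
      ring
    have e4 : a * x' - w = x' * ε ^ 2 := mul_left_cancel₀ (pow_ne_zero _ hx'0) e2
    have hw0 : w - 0 ^ 2 ∈ Ideal.span {x'} :=
      Ideal.mem_span_singleton'.mpr ⟨a - ε ^ 2, by linear_combination e4⟩
    obtain ⟨hne, -⟩ := sq_mod_exc_of_weakTransform hdom hx₀m hx₀0 hmin hS' hg₀ (hexact g₀) hx₀S' w 0 hw hw0
    exact hne rfl

end VisitLaw

end Summit.ResolutionOfSingularities.ResolutionOfSingularities.Theorems.SwitchingDichotomy

end
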